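import Summits.ResolutionOfSingularities.ResolutionOfSingularities.Theorems.WeightedInvariantDescentPerfectToAllOneRootReduction
import Summits.ResolutionOfSingularities.ResolutionOfSingularities.Theorems.WeightedInvariantDescentPerfectToAllOneRootReduceToIntegral
import Summits.ResolutionOfSingularities.ResolutionOfSingularities.Theorems.WeightedInvariantDescentPerfectToAllOneRootReduceToGeomIntegral
import Summits.ResolutionOfSingularities.ResolutionOfSingularities.Theorems.PAlterationPicoverToRadicialBottom

/-!
# Cross-route link: `Picover` (stmt-ResolutionOfSingularities-0554) ⇒ `DescentPerfectToAll` (stmt-0549)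

Route `ResolutionOfSingularities/WeightedInvariant` (crux `DescentPerfectToAll` shared verbatim with `Descent` and
`UniformComplexity`), line `root-of-a-constant` of the lead prover-line-stmt-ResolutionOfSingularities-0549-c1-0;
by-product flagged by planner-plan-novel-ResolutionOfSingularities-…-v2-0 (2026-08-16T15:44Z) and kernel-checked here.

The one-root core of the line ("for `a ∈ k ∖ k^p`, `K = k(a^{1/p})`, `X` integral with `X ⊗_k K` integral:
`HasResolution (X ⊗_k K) → HasResolution X`") is the constant-coefficient special case of route pAlteration's
RADICIAL BOTTOM ("resolutions descend along finite, universally injective, surjective morphisms of integral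
varieties"): `X ⊗_k K → X` is the base change of `Spec K → Spec k`, which is finite, purely inseparable (hence
universally injective) and surjective. Route pAlteration PROVED `PicoverToRadicialBottom` (stmt-0556,
`picoverToRadicialBottom_proof`), so its crux `Picover` (stmt-0554: purely inseparable covers of regular varieties are
resolvable) implies the radicial bottom, hence the one-root core, hence — by the landed reductions of this line
(`stub_oneRootReduceToGeomIntegral` p108841, `stub_oneRootReduceToIntegral` p107667) and
`descentPerfectToAll_of_oneRootStep` (p106869: perfect closure + limit descent + radicial tower) — `DescentPerfectToAll`.

* `oneRootStepCore_of_radicialBottom` — radicial bottom at `p` ⇒ one-root core at `p`.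
* `descentPerfectToAll_of_picover` — `Picover → DescentPerfectToAll`.

Nothing here is new mathematics; both cruxes remain open.
-/

noncomputable section

set_option linter.dupNamespace false -- mandated namespace of this single-conjunct summit

open CategoryTheory CategoryTheory.Limits AlgebraicGeometry
open Literature.AlgebraicGeometry.Resolution

namespace Summit.ResolutionOfSingularities.ResolutionOfSingularities.Theorems

/-- **Radicial bottom ⇒ the one-root core.** If resolutions descend along every finite, universally injective,
surjective morphism of integral separated finite-type `k`-schemes (the consequent of route pAlteration's
`PicoverToRadicialBottom` at the prime `p`), then the one-root core holds at `p`: `X ⊗_k k(a^{1/p}) → X` is such a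
morphism (base change of `Spec k(a^{1/p}) → Spec k`: finite, purely inseparable hence universally injective,
surjective). [folklore] -/
theorem oneRootStepCore_of_radicialBottom (p : ℕ) [Fact p.Prime] (hRB : (∀ (k : Type) [Field k] [CharP k p] (X X'' : Scheme.{0}) (f : X ⟶ Spec (.of k)) (g : X'' ⟶ X), IsSeparated f → LocallyOfFiniteType f → QuasiCompact f → IsIntegral X → IsIntegral X'' → IsFinite g → UniversallyInjective g → Function.Surjective g.base → Scheme.HasResolution X'' → Scheme.HasResolution X)) : (∀ (k K : Type) [Field k] [Field K] [Algebra k K] [CharP k p] (a : k) (α : K), (∀ b : k, b ^ p ≠ a) → α ^ p = algebraMap k K a → IntermediateField.adjoin k {α} = ⊤ → ∀ (X : Scheme.{0}) (f : X ⟶ Spec (.of k)), IsSeparated f → LocallyOfFiniteType f → QuasiCompact f → IsIntegral X → IsIntegral (pullback f (Spec.map (CommRingCat.ofHom (algebraMap k K)))) → Scheme.HasResolution (pullback f (Spec.map (CommRingCat.ofHom (algebraMap k K)))) → Scheme.HasResolution X) := by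
  intro k K _ _ _ _ a α _ hα htop X f hsep hlft hqc hint hintK hres
  haveI : IsPurelyInseparable k K := isPurelyInseparable_of_pow_eq a α hα htop
  haveI : FiniteDimensional k (⊤ : IntermediateField k K) := by
    rw [← htop]; exact IntermediateField.adjoin.finiteDimensional (isIntegral_of_pow_eq a α hα)
  haveI : FiniteDimensional k K := IntermediateField.topEquiv.toLinearEquiv.finiteDimensional
  haveI : IsFinite (Spec.map (CommRingCat.ofHom (algebraMap k K))) := by
    rw [IsFinite.SpecMap_iff, CommRingCat.hom_ofHom, RingHom.finite_algebraMap]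
    infer_instance
  haveI : IsFinite (pullback.fst f (Spec.map (CommRingCat.ofHom (algebraMap k K)))) :=
    MorphismProperty.pullback_fst _ _ inferInstance
  haveI := universallyInjective_SpecMap_of_isPurelyInseparable k K
  haveI : UniversallyInjective (pullback.fst f (Spec.map (CommRingCat.ofHom (algebraMap k K)))) :=
    MorphismProperty.pullback_fst _ _ inferInstance
  haveI : Surjective (pullback.fst f (Spec.map (CommRingCat.ofHom (algebraMap k K)))) :=
    MorphismProperty.pullback_fst _ _ inferInstance
  haveI := hint
  haveI := hintK
  exact hRB k X _ f (pullback.fst f (Spec.map (CommRingCat.ofHom (algebraMap k K)))) hsep hlft hqc hint hintK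
    inferInstance inferInstance (Surjective.surj) hres

/-- **`Picover` ⇒ `DescentPerfectToAll`** (crux stmt-0554 of route pAlteration implies crux stmt-0549 of routes
Descent / WeightedInvariant / UniformComplexity): `Picover` gives the radicial bottom (`picoverToRadicialBottom_proof`,
stmt-0556, proved), hence the one-root core, hence — through the landed reductions of the line `root-of-a-constant`
(geometric integrality p108841, irreducible components p107667) and `descentPerfectToAll_of_oneRootStep` (p106869:
perfect closure, limit descent, radicial tower) — the crux. [folklore] -/
theorem descentPerfectToAll_of_picover : Summit.ResolutionOfSingularities.ResolutionOfSingularities.Theses.PAlteration.Picover → Summit.ResolutionOfSingularities.ResolutionOfSingularities.Theses.WeightedInvariant.DescentPerfectToAll :=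
  fun h => descentPerfectToAll_of_oneRootStep fun p hp _ =>
    stub_oneRootReduceToIntegral p (stub_oneRootReduceToGeomIntegral p
      (oneRootStepCore_of_radicialBottom p (picoverToRadicialBottom_proof p hp.out (h p hp.out))))

end Summit.ResolutionOfSingularities.ResolutionOfSingularities.Theorems

end
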